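import Summits.ResolutionOfSingularities.ResolutionOfSingularities.Theorems.WeightedInvariantLocalWeightedDropMonomialPhase
import Summits.ResolutionOfSingularities.ResolutionOfSingularities.Theorems.WeightedInvariantLocalWeightedDropTameResidualOfTupleDrop
import Summits.ResolutionOfSingularities.ResolutionOfSingularities.Theorems.WeightedInvariantLocalWeightedDropTameFourResidualOfCJSB

/-!
# `WeightedInvariant.LocalWeightedDrop`: the TAME residual stubs of the engine follow from a radical non-normal-crossing count alone

Crux item stmt-ResolutionOfSingularities-8899 `LocalWeightedDrop` (route `ResolutionOfSingularities/WeightedInvariant`), registered skeleton of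
res-L1-w43-lead-1 (residual split: `stub_tameWideApexFourStartsWon`, `stub_tameWideApexHigherStartsWon`).  [OURS · L1 W4.3, chain w43, unit
res-L1-w43-stub-8 (seat res-D-pv-006); proofs of registered stubs WITH AN EXTRA HYPOTHESIS — nothing is closed by name.]

With the monomial phase proved in every dimension (`germMonomialPhase`, file `…MonomialPhase`) and res-type-088's assembly (p501911), the
coefficient-tuple game `TupleGame.Drop k (n + 1) e` is won from strategist res-L1-w43-strat-1's count hypothesis `GermNonNCCountRad k n`
alone (`tupleDrop_of_germNonNCCountRad`); by stub-4's `tameWideApexFourStartsWon_of_tupleDrop` / `tameWideApexHigherStartsWon_of_tupleDrop`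
(p500325) the tame residuals follow:

* `tameWideApexFourStartsWon_of_spaceGermNonNCCountRad` — the registered N = 4 tame residual `stub_tameWideApexFourStartsWon` (statement
  VERBATIM) from `∀ k, SpaceGermNonNCCountRad k` (the line's (A3) target, there to be derived from ⟨F-32bR⟩);
* `tameWideApexHigherStartsWon_of_germNonNCCountRad` — the registered tame residual `stub_tameWideApexHigherStartsWon` (all `N ≥ 4`, VERBATIM)
  from radical counts in every dimension `≥ 3` (`∀ k n, GermNonNCCountRad k (n + 2)`).
* **`tameWideApexFourStartsWon_of_CJS`** — THE LINE'S CONCLUSION: the N = 4 tame residual `stub_tameWideApexFourStartsWon` VERBATIM, modulo the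
  vendored named fact ⟨F-32bR⟩ `CossartJannsenSaito2020EmbeddedSequenceB` ONLY (res-type-088's `tameWideApexFourStartsWon_of_CJSB`, whose (A3)
  input is p504769 and whose remaining hypothesis — the monomial phase over every field — is `stub_spaceMonomialPhase`).
-/

set_option linter.dupNamespace false -- mandated namespace of this single-conjunct summit

namespace Summit.ResolutionOfSingularities.ResolutionOfSingularities.Theorems

open Literature.AlgebraicGeometry.Resolution

/-- **THE N = 4 TAME RESIDUAL FROM THE THREE-VARIABLE COUNT** (`stub_tameWideApexFourStartsWon` VERBATIM as conclusion): if every field carries a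
radical non-normal-crossing count with free smooth centres on `k⟦x₀,x₁,x₂⟧` (the line's (A3)-shape hypothesis `SpaceGermNonNCCountRad k`), then
every tame singular germ in four variables covered by the residual stub is won. [OURS · L1 W4.3; stub with an extra hypothesis] -/
theorem tameWideApexFourStartsWon_of_spaceGermNonNCCountRad
    (hrad : ∀ (k : Type) [Field k], TameFourTupleDrop.SpaceGermNonNCCountRad k) :
    ∀ (p : ℕ), p.Prime → ∀ (k : Type) [Field k] [CharP k p] [IsAlgClosed k],
    (∀ m : ℕ, m < 4 → ∀ g : MvPowerSeries (Fin m) k,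
      CobordantGame.IsSingular k g → CobordantGame.Won k m g) →
    ∀ (f : MvPowerSeries (Fin 4) k), CobordantGame.IsSingular k f →
    (∀ g : MvPowerSeries (Fin 4) k, CobordantGame.IsSingular k g → g.order < f.order →
      CobordantGame.Won k 4 g) →
    ∀ (d : ℕ), f.order = d → ¬ p ∣ d →
    (∃ ℓ : Fin 4 → k, ∀ i j : Fin 4,
      MvPowerSeries.coeff (Finsupp.single i 1 + Finsupp.single j 1) f =
        MvPowerSeries.coeff (Finsupp.single i 1 + Finsupp.single j 1)
          ((∑ l, MvPowerSeries.C (ℓ l) * MvPowerSeries.X l) ^ 2)) →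
    (2 < d → ∃ c₁ c₂ : Fin 4 → k, (∀ α β : k, α • c₁ + β • c₂ = 0 → α = 0 ∧ β = 0) ∧
      (∀ v : Fin 4 → k, CobordantChart.initEval (fun _ : Fin 4 => 1) (v + c₁) d f =
        CobordantChart.initEval (fun _ : Fin 4 => 1) v d f) ∧
      (∀ v : Fin 4 → k, CobordantChart.initEval (fun _ : Fin 4 => 1) (v + c₂) d f =
        CobordantChart.initEval (fun _ : Fin 4 => 1) v d f)) →
    CobordantGame.Won k 4 f :=
  tameWideApexFourStartsWon_of_tupleDrop fun _ _ k _ _ _ e =>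
    TameFourTupleDrop.tupleDropThree_of_spaceGermNonNCCountRad k (hrad k) e

/-- **THE TAME RESIDUAL IN ALL DIMENSIONS `N ≥ 4` FROM RADICAL COUNTS** (`stub_tameWideApexHigherStartsWon` VERBATIM as conclusion): radical
non-normal-crossing counts with free smooth centres in every dimension `≥ 3` (`GermNonNCCountRad k (n + 2)`, the (A3)-shape hypothesis one
dimension up each time) win every tame singular germ covered by the residual stub. [OURS · L1 W4.3; stub with an extra hypothesis] -/
theorem tameWideApexHigherStartsWon_of_germNonNCCountRad
    (hrad : ∀ (k : Type) [Field k] (n : ℕ), TameFourTupleDrop.GermNonNCCountRad k (n + 2)) :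
    ∀ (p : ℕ), p.Prime → ∀ (k : Type) [Field k] [CharP k p] [IsAlgClosed k]
    (n : ℕ), (∀ m : ℕ, m < n + 4 → ∀ g : MvPowerSeries (Fin m) k,
      CobordantGame.IsSingular k g → CobordantGame.Won k m g) →
    ∀ (f : MvPowerSeries (Fin (n + 4)) k), CobordantGame.IsSingular k f →
    (∀ g : MvPowerSeries (Fin (n + 4)) k, CobordantGame.IsSingular k g → g.order < f.order →
      CobordantGame.Won k (n + 4) g) →
    ∀ (d : ℕ), f.order = d → ¬ p ∣ d →
    (∃ ℓ : Fin (n + 4) → k, ∀ i j : Fin (n + 4),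
      MvPowerSeries.coeff (Finsupp.single i 1 + Finsupp.single j 1) f =
        MvPowerSeries.coeff (Finsupp.single i 1 + Finsupp.single j 1)
          ((∑ l, MvPowerSeries.C (ℓ l) * MvPowerSeries.X l) ^ 2)) →
    (2 < d → ∃ c₁ c₂ : Fin (n + 4) → k, (∀ α β : k, α • c₁ + β • c₂ = 0 → α = 0 ∧ β = 0) ∧
      (∀ v : Fin (n + 4) → k, CobordantChart.initEval (fun _ : Fin (n + 4) => 1) (v + c₁) d f =
        CobordantChart.initEval (fun _ : Fin (n + 4) => 1) v d f) ∧
      (∀ v : Fin (n + 4) → k, CobordantChart.initEval (fun _ : Fin (n + 4) => 1) (v + c₂) d f =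
        CobordantChart.initEval (fun _ : Fin (n + 4) => 1) v d f)) →
    CobordantGame.Won k (n + 4) f := by
  refine tameWideApexHigherStartsWon_of_tupleDrop fun _ _ k _ _ _ m e hm => ?_
  obtain ⟨n, rfl⟩ : ∃ n, m = n + 2 + 1 := ⟨m - 3, by omega⟩
  exact tupleDrop_of_germNonNCCountRad k (n + 2) (hrad k n) e

/-- **THE N = 4 TAME RESIDUAL OF THE ENGINE, MODULO ⟨F-32bR⟩ ONLY** — the conclusion of strategist res-L1-w43-strat-1's line
`tame-four-tuple-drop`: `CossartJannsenSaito2020EmbeddedSequenceB → stub_tameWideApexFourStartsWon` (statement VERBATIM), all three stubs (A3)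
p504769, (B3) `stub_spaceMonomialPhase`, (G3) p501911 being tree theorems. [OURS · L1 W4.3; registered stub with the named fact as hypothesis] -/
theorem tameWideApexFourStartsWon_of_CJS (hCJS : CossartJannsenSaito2020EmbeddedSequenceB.{0}) :
    ∀ (p : ℕ), p.Prime → ∀ (k : Type) [Field k] [CharP k p] [IsAlgClosed k],
    (∀ m : ℕ, m < 4 → ∀ g : MvPowerSeries (Fin m) k,
      CobordantGame.IsSingular k g → CobordantGame.Won k m g) →
    ∀ (f : MvPowerSeries (Fin 4) k), CobordantGame.IsSingular k f →
    (∀ g : MvPowerSeries (Fin 4) k, CobordantGame.IsSingular k g → g.order < f.order →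
      CobordantGame.Won k 4 g) →
    ∀ (d : ℕ), f.order = d → ¬ p ∣ d →
    (∃ ℓ : Fin 4 → k, ∀ i j : Fin 4,
      MvPowerSeries.coeff (Finsupp.single i 1 + Finsupp.single j 1) f =
        MvPowerSeries.coeff (Finsupp.single i 1 + Finsupp.single j 1)
          ((∑ l, MvPowerSeries.C (ℓ l) * MvPowerSeries.X l) ^ 2)) →
    (2 < d → ∃ c₁ c₂ : Fin 4 → k, (∀ α β : k, α • c₁ + β • c₂ = 0 → α = 0 ∧ β = 0) ∧
      (∀ v : Fin 4 → k, CobordantChart.initEval (fun _ : Fin 4 => 1) (v + c₁) d f =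
        CobordantChart.initEval (fun _ : Fin 4 => 1) v d f) ∧
      (∀ v : Fin 4 → k, CobordantChart.initEval (fun _ : Fin 4 => 1) (v + c₂) d f =
        CobordantChart.initEval (fun _ : Fin 4 => 1) v d f)) →
    CobordantGame.Won k 4 f :=
  TameFourTupleDrop.tameWideApexFourStartsWon_of_CJSB hCJS fun k _ => TameFourTupleDrop.stub_spaceMonomialPhase k

end Summit.ResolutionOfSingularities.ResolutionOfSingularities.Theorems
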